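import Literature.Computability.QuantumComplexity.CubicForrelation
import Literature.Computability.QuantumComplexity.IQPForrelation
import Literature.Computability.QuantumComplexity.QuadraticPolarForm
import Literature.Computability.Complexity.F2RowReduction

/-!
# Crux `CubicForrelation.SignedCubicForrelationInPrBPP` (stmt-QuantumAdvantage-13933)

Stub `stub_certify` of the line `polar-radical-seeds` (the M-subspace certificate is a finite check).

For a Boolean function `g : {0,1}ⁿ → {0,1}` of algebraic (`𝔽₂`-) degree `≤ 3` and a list of bit rows
`L`, write `D_u D_v g (y) := g y ⊕ g (y ⊕ u) ⊕ g (y ⊕ v) ⊕ g (y ⊕ u ⊕ v)` for the second difference.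
If `D_r D_s g` vanishes at `y = 0` and at the `n` unit vectors for every pair of rows `r, s ∈ L`,
then `D_u D_v g ≡ 0` for all `u, v` in the `𝔽₂`-span of the rows (read back as bit vectors), i.e. `g`
is affine on every coset of that span.

Proof (all in the tree's derivative calculus `CHHL2018.der` / `CHHL2018.lowDeg` of
`F2PolynomialFourierTailsLevelKProofs.lean`, bridged from `IsDegLeFun` by
`QuadPolar.toZFun_mem_lowDeg_of_poly`):
1. `[g] ∈ lowDeg n 3`, so every second derivative `D_u D_v [g]` lies in `lowDeg n 1`; a function
   `H ∈ lowDeg n 1` satisfies `H (a ⊕ b) + H a = H b + H 0`, hence is additive when `H 0 = 0`, and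
   an additive function vanishing at the unit vectors vanishes identically (induction on the
   support). So `D_r D_s [g] ≡ 0` for all pairs of rows.
2. `D_0 K ≡ 0`, the cocycle identity `D_{a ⊕ b} K (x) = D_a K (x ⊕ b) + D_b K (x)` and
   `Submodule.span_induction` (scalars of `𝔽₂` are `0, 1`; `a ↦ (i ↦ [aᵢ = 1])` turns `+` into `⊕`)
   extend the vanishing from the rows to the row span in the outer slot; commuting the two
   derivatives and repeating extends it in the inner slot.
-/

noncomputable section

set_option linter.dupNamespace false -- D-0017: single-problem summit ⇒ `QuantumAdvantage.QuantumAdvantage` by design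

namespace Summit.QuantumAdvantage.QuantumAdvantage.Theorems.SignedCubicForrelationInPrBPP

open Literature.Computability.Complexity Literature.Computability.QuantumComplexity
open Literature.Computability.QuantumComplexity.BuzetChailloux (bxor zeroVec)
open Literature.Computability.QuantumComplexity.CHHL2018 (der der_apply lowDeg mem_lowDeg_succ
  mem_lowDeg_zero xorVec_right_comm decide_add_eq_one)
open Literature.Computability.QuantumComplexity.QuadPolar (toZFun toZFun_apply
  toZFun_mem_lowDeg_of_poly xorVec_zero_left xorVec_zero_right two_eq_zero)
open Literature.Computability.Complexity.LowDegree (xorVec xorVec_apply)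
open Literature.Computability.Complexity.BLR (toZ toZ_xor)

variable {n : ℕ}

/-! ### Degree `≤ 1`: affine functions vanishing at `0` and the unit vectors vanish -/

/-- A function of degree `≤ 1` (all second derivatives vanish) satisfies the affine law
`H (a ⊕ b) + H a = H b + H 0`. -/
private theorem apply_xorVec_add_of_mem_lowDeg_one {H : (Fin n → Bool) → ZMod 2}
    (hH : H ∈ lowDeg n 1) (a b : Fin n → Bool) :
    H (xorVec a b) + H a = H b + H (fun _ => false) := by
  have h := (mem_lowDeg_zero.1 (mem_lowDeg_succ.1 hH b)) a (fun _ => false)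
  simpa only [der_apply, xorVec_zero_left] using h

/-- An additive function on the cube vanishing at the unit vectors vanishes on every vector supported
below `k` (induction on `k`). -/
private theorem eq_zero_of_additive_aux {H : (Fin n → Bool) → ZMod 2}
    (hadd : ∀ a b, H (xorVec a b) = H a + H b)
    (h1 : ∀ i : Fin n, H (fun j => decide (j = i)) = 0) :
    ∀ (k : ℕ) (y : Fin n → Bool), (∀ j : Fin n, k ≤ j.val → y j = false) → H y = 0
  | 0, y, hy => by
      have e : y = fun _ => false := funext fun j => hy j (Nat.zero_le _)
      have h0 := hadd (fun _ => false) (fun _ => false)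
      rw [QuadPolar.xorVec_self] at h0
      rw [e]
      -- `H 0 = H 0 + H 0` forces `H 0 = 0`
      linear_combination -h0
  | k + 1, y, hy => by
      by_cases hk : k < n
      · set i : Fin n := ⟨k, hk⟩
        by_cases hyi : y i = true
        · have e : y = xorVec (Function.update y i false) (fun j => decide (j = i)) := by
            funext j
            by_cases hj : j = i
            · subst hj; simp [hyi]
            · simp [hj]
          rw [e, hadd, h1 i, add_zero]
          refine eq_zero_of_additive_aux hadd h1 k _ fun j hj => ?_
          by_cases hj' : j = i
          · subst hj'; simp
          · rw [Function.update_of_ne hj']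
            refine hy j ?_
            have : j.val ≠ k := fun h => hj' (Fin.ext (by rw [h]))
            omega
        · refine eq_zero_of_additive_aux hadd h1 k y fun j hj => ?_
          by_cases hj' : j = i
          · subst hj'; simpa using hyi
          · refine hy j ?_
            have : j.val ≠ k := fun h => hj' (Fin.ext (by rw [h]))
            omega
      · exact eq_zero_of_additive_aux hadd h1 k y fun j hj => absurd hj (by have := j.isLt; omega)

/-- **A degree-`≤ 1` function vanishing at `0` and at the unit vectors vanishes identically.** -/
private theorem eq_zero_of_mem_lowDeg_one {H : (Fin n → Bool) → ZMod 2} (hH : H ∈ lowDeg n 1)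
    (h0 : H (fun _ => false) = 0) (h1 : ∀ i : Fin n, H (fun j => decide (j = i)) = 0)
    (y : Fin n → Bool) : H y = 0 := by
  have hadd : ∀ a b, H (xorVec a b) = H a + H b := fun a b => by
    have e := apply_xorVec_add_of_mem_lowDeg_one hH a b
    rw [h0, add_zero] at e
    linear_combination e - (H a) * two_eq_zero
  exact eq_zero_of_additive_aux hadd h1 n y fun j hj => absurd j.isLt (not_lt.2 hj)

/-! ### Second differences as iterated derivatives -/

/-- The Boolean second difference `g y ⊕ g (y ⊕ u) ⊕ g (y ⊕ v) ⊕ g (y ⊕ u ⊕ v)` reads in `𝔽₂` as the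
iterated derivative `D_u D_v [g] (y)`. -/
private theorem toZ_secondDiff (g : (Fin n → Bool) → Bool) (u v y : Fin n → Bool) :
    toZ (g y ^^ g (bxor y u) ^^ g (bxor y v) ^^ g (bxor y (bxor u v))) =
      der u (der v (toZFun g)) y := by
  have e1 : xorVec y u = bxor y u := rfl
  have e2 : xorVec y v = bxor y v := rfl
  have e3 : xorVec (xorVec y u) v = bxor y (bxor u v) := funext fun i => Bool.xor_assoc _ _ _
  simp only [der_apply, toZFun_apply]
  rw [e3, e1, e2, toZ_xor, toZ_xor, toZ_xor]
  ring

/-- Derivatives commute: `D_a D_b K = D_b D_a K`. -/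
private theorem der_comm (K : (Fin n → Bool) → ZMod 2) (a b : Fin n → Bool) :
    der a (der b K) = der b (der a K) := by
  funext x
  simp only [der_apply, xorVec_right_comm x a b]
  ring

/-- The cocycle identity `D_{a ⊕ b} K (x) = D_a K (x ⊕ b) + D_b K (x)`. -/
private theorem der_xorVec (K : (Fin n → Bool) → ZMod 2) (a b x : Fin n → Bool) :
    der (xorVec a b) K x = der a K (xorVec x b) + der b K x := by
  have e : xorVec (xorVec x b) a = xorVec x (xorVec a b) := by
    funext i; simp only [xorVec_apply]; cases x i <;> cases a i <;> cases b i <;> rfl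
  simp only [der_apply]
  rw [e]
  linear_combination (-(K (xorVec x b))) * two_eq_zero

/-! ### From the rows to the row span -/

/-- If `D_r K ≡ 0` for every row `r` of `L`, then `D_u K ≡ 0` for every bit vector `u` whose
`𝔽₂`-reading lies in the row span of `L` (span induction with the cocycle identity). -/
private theorem der_eq_zero_of_mem_rowSpan (K : (Fin n → Bool) → ZMod 2) (L : List (List Bool))
    (hrows : ∀ r ∈ L, ∀ y, der (fun i : Fin n => r.getD i false) K y = 0) {u : Fin n → Bool}
    (hu : (fun i => if u i then (1 : ZMod 2) else 0) ∈ F2Elim.rowSpan n L) :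
    ∀ y, der u K y = 0 := by
  have h01 : ∀ c : ZMod 2, c = 0 ∨ c = 1 := by decide
  have hzero : ∀ y, der (fun i => decide ((0 : Fin n → ZMod 2) i = 1)) K y = 0 := by
    intro y
    have e : (fun i => decide ((0 : Fin n → ZMod 2) i = 1)) = fun _ => false := funext fun _ => rfl
    rw [e, der_apply, xorVec_zero_right]
    exact CharTwo.add_self_eq_zero _
  have key : ∀ a ∈ Submodule.span (ZMod 2) (F2Elim.rowSet n L), ∀ y,
      der (fun i => decide (a i = 1)) K y = 0 := by
    intro a ha
    induction ha using Submodule.span_induction with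
    | mem a h =>
        obtain ⟨r, hr, rfl⟩ := h
        have e : (fun i => decide (F2Elim.vecZ n r i = 1)) = fun i : Fin n => r.getD i false := by
          funext i
          show decide (toZ (r.getD i false) = 1) = r.getD i false
          cases r.getD i false <;> rfl
        rw [e]
        exact hrows r hr
    | zero => exact hzero
    | add a b _ _ ha hb =>
        intro y
        have e : (fun i => decide ((a + b) i = 1)) =
            xorVec (fun i => decide (a i = 1)) (fun i => decide (b i = 1)) :=
          funext fun i => decide_add_eq_one (a i) (b i)
        rw [e, der_xorVec, ha, hb, add_zero]
    | smul c a _ ha =>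
        rcases h01 c with rfl | rfl
        · rw [zero_smul]; exact hzero
        · rw [one_smul]; exact ha
  have e : u = fun i => decide ((fun j => if u j then (1 : ZMod 2) else 0) i = 1) := by
    funext i
    show u i = decide ((if u i then (1 : ZMod 2) else 0) = 1)
    cases u i <;> rfl
  intro y
  rw [e]
  exact key _ hu y

/-! ### The stub -/

/-- **Stub `stub_certify`** (line `polar-radical-seeds` of crux `SignedCubicForrelationInPrBPP`). For `g` of
`𝔽₂`-degree `≤ 3` and rows `L`: if the second difference `D_r D_s g` vanishes at `0` and at every unit
vector for all pairs of rows `r, s ∈ L`, then `D_u D_v g ≡ 0` for all bit vectors `u, v` whose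
`𝔽₂`-readings lie in the row span of `L` — `g` is affine on every coset of that span. Two derivatives of
a cubic have degree `≤ 1`, an affine function vanishing at `0` and the unit vectors vanishes, and the
vanishing extends from generators to the span by the cocycle identity. -/
theorem stub_certify : ∀ (n : ℕ) (g : (Fin n → Bool) → Bool), IsDegLeFun 3 g →
    ∀ L : List (List Bool),
    (∀ r ∈ L, ∀ s ∈ L, ∀ y : Fin n → Bool, (y = zeroVec ∨ ∃ i : Fin n, y = fun j => decide (j = i)) →
      (g y ^^ g (bxor y (fun i => r.getD i false)) ^^ g (bxor y (fun i => s.getD i false)) ^^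
        g (bxor y (bxor (fun i => r.getD i false) (fun i => s.getD i false)))) = false) →
    ∀ u v : Fin n → Bool, (fun i => if u i then (1 : ZMod 2) else 0) ∈ F2Elim.rowSpan n L →
      (fun i => if v i then (1 : ZMod 2) else 0) ∈ F2Elim.rowSpan n L →
    ∀ y, (g y ^^ g (bxor y u) ^^ g (bxor y v) ^^ g (bxor y (bxor u v))) = false := by
  intro n g hg L hL u v hu hv y
  obtain ⟨p, hp, hgp⟩ := hg
  have hG : toZFun g ∈ lowDeg n 3 := toZFun_mem_lowDeg_of_poly p hp hgp
  -- (1) all pairs of rows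
  have hrow : ∀ r ∈ L, ∀ s ∈ L, ∀ y,
      der (fun i => r.getD i false) (der (fun i => s.getD i false) (toZFun g)) y = 0 := by
    intro r hr s hs
    have hdeg : der (fun i => r.getD i false) (der (fun i => s.getD i false) (toZFun g)) ∈ lowDeg n 1 :=
      mem_lowDeg_succ.1 (mem_lowDeg_succ.1 hG _) _
    have hval : ∀ y, (y = zeroVec ∨ ∃ i : Fin n, y = fun j => decide (j = i)) →
        der (fun i => r.getD i false) (der (fun i => s.getD i false) (toZFun g)) y = 0 := by
      intro y hy
      have h := hL r hr s hs y hy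
      rw [← F2Elim.toZ_eq_zero_iff, toZ_secondDiff] at h
      exact h
    exact eq_zero_of_mem_lowDeg_one hdeg (hval _ (Or.inl rfl)) (fun i => hval _ (Or.inr ⟨i, rfl⟩))
  -- (2) outer slot: from the rows to `u` in the span, for each row `s` in the inner slot
  have hu' : ∀ s ∈ L, ∀ y, der u (der (fun i => s.getD i false) (toZFun g)) y = 0 := fun s hs =>
    der_eq_zero_of_mem_rowSpan _ L (fun r hr => hrow r hr s hs) hu
  -- (3) inner slot: commute and repeat for `v`
  have huv : ∀ y, der v (der u (toZFun g)) y = 0 :=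
    der_eq_zero_of_mem_rowSpan _ L (fun s hs y => by rw [der_comm]; exact hu' s hs y) hv
  refine (F2Elim.toZ_eq_zero_iff _).1 ?_
  rw [toZ_secondDiff, der_comm]
  exact huv y

end Summit.QuantumAdvantage.QuantumAdvantage.Theorems.SignedCubicForrelationInPrBPP

end
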